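import Mathlib
import Summits.Ventures.PercRepro2.Defs
import Summits.Ventures.PercRepro2.Independence
import Summits.Ventures.PercRepro2.Harris
import Summits.Ventures.PercRepro2.Graph
import Summits.Ventures.PercRepro2.Exploration
import Summits.Ventures.PercRepro2.Events
import Summits.Ventures.PercRepro2.FourFunctions
import Summits.Ventures.PercRepro2.Induced
import Summits.Ventures.PercRepro2.Frontier
import Summits.Ventures.PercRepro2.ObsIndependence
import Summits.Ventures.PercRepro2.BHK
import Summits.Ventures.PercRepro2.BHKEvents
import Summits.Ventures.PercRepro2.BHKAvoid
import Summits.Ventures.PercRepro2.SameClusterAvoid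
import Summits.Ventures.PercRepro2.CaseOneRegime
import Summits.Ventures.PercRepro2.CaseOnePos
import Summits.Ventures.PercRepro2.CaseOneJ11
import Summits.Ventures.PercRepro2.CaseOneRV
import Summits.Ventures.PercRepro2.TriDisagreement
import Summits.Ventures.PercRepro2.HCovCubic

/-!
# The case-1 rung as a CUBIC FORM: the state kernel `KII` with `iiExpr = triSum p ∅ τ KII`, and
`(ii)` from the typed three-copy bases (blind cell PercRepro2, p1 g13; ASSIGNMENTS v12.57 «the STATE
KERNEL `KII` with `iiExpr = triSum p ∅ τ KII` … the missing piece that gives S5 the (TRI) architecture in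
the kernel»; S5 §2.2 / §2.3)

The cleared `(ii)` is the four-term cubic
`N₂ = P(ABO) P(Q) P(PD) + P(QB) P(PDoU) P(A) − P(QB) P(AO) P(PD) − P(AB) P(PDoU) P(Q)` (mine-1 §17.1;
`CaseOne.iiExpr_eq_probs`), so it is the cubic form `Σ_{x,y,z} P(x) P(y) P(z) KII(x, y, z)` of the
**four-term separable kernel `KII`** — `CovForm.sepKernel` with coefficients `(1, 1, −1, −1)` on the
indicator triples `(1_ABO, 1_Q, 1_PD)`, `(1_QB, 1_PDoU, 1_A)`, `(1_QB, 1_AO, 1_PD)`, `(1_AB, 1_PDoU, 1_Q)`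
(**`iiExpr_cubic`**, via `triSum_empty_sepKernel`). Hence the typed three-copy sums `triSum p F τ KII`
of `TriDisagreement.lean` are available for `(ii)` exactly as `K₃` is for (HCOV): the TYPED `(ii)` is
«every typed sum of `KII` with the free edges pinned is nonnegative» (`TypedII`), and p1's pinning
reduction gives **`zSplitII_of_pinned`**: `TypedII ⟹ (ii)` for every admissible weight vector, and
**`rv_of_pinned`**: `TypedII ⟹ (RV)`. This is the (TRI) architecture for the case-1 rung in the kernel:
p2's reduction calculus applies to `KII` verbatim (the rules are stated for an arbitrary kernel), and the
all-marked base is the K₅ certificate (typer-1) / mine-1's star injection (MINE1-J1.md §21). Nothing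
about `TypedII` itself is claimed. -/

namespace Summit.Ventures.PercRepro2

namespace CaseOne

open CovForm

section Kernel
variable {V : Type*} {E : Type*} [Fintype E] [DecidableEq E] {R : Type*} [Field R]

/-- The eight events of the four-term identity, as indicator functions (all intersected with `Q`):
`A = {a₃ ∈ C₁}`, `B = {b ∈ C₂}`, `O = {o ∈ C₂}`, `PD`, `PDoU = PD ∩ {o ∈ U}`. -/
noncomputable def iQ (ends : E → Sym2 V) (a₁ a₂ : V) : Config E → R :=
  ((connEvent ends a₁ a₂)ᶜ).indicator 1

/-- `1_A = 1[a₃ ∈ C₁] 1_Q`. -/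
noncomputable def iA (ends : E → Sym2 V) (a₁ a₂ a₃ : V) : Config E → R :=
  (connEvent ends a₁ a₃ ∩ (connEvent ends a₁ a₂)ᶜ).indicator 1

/-- `1_QB = 1[b ∈ C₂] 1_Q`. -/
noncomputable def iQB (ends : E → Sym2 V) (a₁ a₂ b : V) : Config E → R :=
  (connEvent ends a₂ b ∩ (connEvent ends a₁ a₂)ᶜ).indicator 1

/-- `1_AB = 1[b ∈ C₂] 1[a₃ ∈ C₁] 1_Q`. -/
noncomputable def iAB (ends : E → Sym2 V) (a₁ a₂ a₃ b : V) : Config E → R :=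
  (connEvent ends a₂ b ∩ connEvent ends a₁ a₃ ∩ (connEvent ends a₁ a₂)ᶜ).indicator 1

/-- `1_AO = 1[a₃ ∈ C₁] 1[o ∈ C₂] 1_Q`. -/
noncomputable def iAO (ends : E → Sym2 V) (o a₁ a₂ a₃ : V) : Config E → R :=
  (connEvent ends a₁ a₃ ∩ connEvent ends a₂ o ∩ (connEvent ends a₁ a₂)ᶜ).indicator 1

/-- `1_ABO = 1[b ∈ C₂] 1[a₃ ∈ C₁] 1[o ∈ C₂] 1_Q`. -/
noncomputable def iABO (ends : E → Sym2 V) (o a₁ a₂ a₃ b : V) : Config E → R :=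
  (connEvent ends a₂ b ∩ connEvent ends a₁ a₃ ∩ connEvent ends a₂ o ∩
    (connEvent ends a₁ a₂)ᶜ).indicator 1

/-- `1_PD = 1[a₃ ∉ U] 1_Q` (the event of `Dpd`). -/
noncomputable def iPDc (ends : E → Sym2 V) (a₁ a₂ a₃ : V) : Config E → R :=
  ((connEvent ends a₁ a₃)ᶜ ∩ (connEvent ends a₂ a₃)ᶜ ∩ (connEvent ends a₁ a₂)ᶜ).indicator 1

/-- `1_PDoU = 1[o ∈ U] 1[a₃ ∉ U] 1_Q` (the event of `Dpdo`). -/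
noncomputable def iPDoU (ends : E → Sym2 V) (o a₁ a₂ a₃ : V) : Config E → R :=
  ((connEvent ends a₁ o ∪ connEvent ends a₂ o) ∩ (connEvent ends a₁ a₃)ᶜ ∩
    (connEvent ends a₂ a₃)ᶜ ∩ (connEvent ends a₁ a₂)ᶜ).indicator 1

/-- **The state kernel of the case-1 rung**: the four-term separable kernel
`KII x y z = 1_ABO(x) 1_Q(y) 1_PD(z) + 1_QB(x) 1_PDoU(y) 1_A(z) − 1_QB(x) 1_AO(y) 1_PD(z) − 1_AB(x) 1_PDoU(y) 1_Q(z)`. -/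
noncomputable def KII (ends : E → Sym2 V) (o a₁ a₂ a₃ b : V) :
    Config E → Config E → Config E → R :=
  sepKernel ![1, 1, -1, -1]
    ![iABO ends o a₁ a₂ a₃ b, iQB ends a₁ a₂ b, iQB ends a₁ a₂ b, iAB ends a₁ a₂ a₃ b]
    ![iQ ends a₁ a₂, iPDoU ends o a₁ a₂ a₃, iAO ends o a₁ a₂ a₃, iPDoU ends o a₁ a₂ a₃]
    ![iPDc ends a₁ a₂ a₃, iA ends a₁ a₂ a₃, iPDc ends a₁ a₂ a₃, iQ ends a₁ a₂]

/-- **`iiExpr` is the cubic form of `KII`**: `iiExpr = Σ_{x,y,z} P(x) P(y) P(z) KII(x, y, z)`. -/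
theorem iiExpr_cubic (p : E → R) (ends : E → Sym2 V) (o a₁ a₂ a₃ b : V) (τ : E → ℕ) :
    iiExpr p ends o a₁ a₂ a₃ b = triSum p ∅ τ (KII ends o a₁ a₂ a₃ b) := by
  unfold KII
  rw [triSum_empty_sepKernel]
  simp only [Fin.sum_univ_succ, Fin.sum_univ_zero, Matrix.cons_val_zero, Matrix.cons_val_succ,
    add_zero]
  unfold iQ iA iQB iAB iAO iABO iPDc iPDoU
  simp only [← prob_eq_expect_indicator]
  rw [iiExpr_eq_probs]
  unfold Dpd Dpdo
  ring

end Kernel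

section Typed
variable {V : Type*} {E : Type*} [Fintype E] [DecidableEq E] {R : Type*} [Field R] [LinearOrder R]
  [IsStrictOrderedRing R]

/-- **The typed `(ii)`**: every typed three-copy sum of `KII` with the free edges pinned (`q ∈ {0, 1}`
off `G`, types in `{1, 2}` on `G`) is nonnegative — the profile-wise positivity of the cleared `(ii)`
in the kernel's vocabulary (`triSum`). A definition only. -/
def TypedII (ends : E → Sym2 V) (o a₁ a₂ a₃ b : V) : Prop :=
  ∀ (q : E → R) (G : Finset E) (σ : E → ℕ), (∀ e, 0 ≤ q e ∧ q e ≤ 1) →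
    (∀ e, e ∉ G → q e = 0 ∨ q e = 1) → (∀ e ∈ G, σ e = 1 ∨ σ e = 2) →
    0 ≤ triSum q G σ (KII ends o a₁ a₂ a₃ b)

/-- **`(ii)` from the typed three-copy bases** (p1's pinning reduction `triSum_nonneg_of_pinned` applied
to `KII`): `TypedII ⟹ ZSplitII` for every admissible weight vector. -/
theorem zSplitII_of_pinned (ends : E → Sym2 V) (o a₁ a₂ a₃ b : V)
    (hbase : TypedII (R := R) ends o a₁ a₂ a₃ b) (p : E → R) (hp : IsProbVec p) :
    ZSplitII p ends o a₁ a₂ a₃ b := by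
  unfold ZSplitII
  rw [iiExpr_cubic p ends o a₁ a₂ a₃ b (fun _ => 0)]
  exact triSum_nonneg_of_pinned (KII ends o a₁ a₂ a₃ b) hbase p
    (fun e => ⟨hp.nonneg e, hp.le_one e⟩) ∅ (fun _ => 0)
    (fun e he => absurd he (Finset.notMem_empty e))

/-- **`(RV)` from the typed three-copy bases** (when the required-vertex world has positive mass). -/
theorem rv_of_pinned (ends : E → Sym2 V) (o a₁ a₂ a₃ b : V)
    (hbase : TypedII (R := R) ends o a₁ a₂ a₃ b) (p : E → R) (hp : IsProbVec p)
    (hT : 0 < prob p (Tp ends a₁ a₂ a₃)) : RV p ends o a₁ a₂ a₃ b :=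
  (rv_iff_ii p ends o a₁ a₂ a₃ b hT).2 (zSplitII_of_pinned ends o a₁ a₂ a₃ b hbase p hp)

end Typed

end CaseOne

end Summit.Ventures.PercRepro2
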